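import Summits.QuantumFields.YangMills.Theorems.BalabanUVNodesK0Stub2OfSockGamma
import Summits.QuantumFields.YangMills.Theorems.BalabanUVNodesK0PrintCubeOfStepTokensR
import Literature.MathematicalPhysics.QuantumFieldTheory.Balaban1983to89.B8Prop6CubeMemberOfThm33GammaAvg
import Literature.Barriers.QuantumFields.UnitaryHaarSmallBall

/-!
# K0⁷ STUB 2 ∕ 2′ FROM [4] THEOREM 3.3 BY NAME, EDITION γ, WITH THE GENUINE AVERAGING LETTER — the K0 end of the cube road «D2γ» re-run on «D3γ′»
# (`B8Prop6CubeMemberOfThm33GammaAvg`): the Thm-3.3 supplier of V18's stub-2 body and of V19's stub-2′ text WITHOUT the averaging binder `havg`, at `𝔸 = M₂(ℂ)`,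
# `τ = Tr` (print's pairing `X·Y = tr XY`, [4] pp. 391–392, up to print's normalisation `tr = Tr∕2` — see v1.1 note) with the trace bound `|Re Tr(x*y)| ≤ 2‖x‖‖y‖` DISCHARGED

Cell `pub-ymgap`, width seat `pub-ymgap-k0-s2-w1` (g3; director-ym №197 ∕ HUMAN RULING D-0149; dag-n06-b WORD 2026-08-28 02:21Z, dag-n05-c GO 02:40Z, dag-lead g15 DEDUP-374).
`--kind proof --supports stmt-QuantumFields-20541 --as helper`.  [6] = [Balaban1985RegularSpaces]; [4] = [Balaban1985BackgroundPropagators]; [B6] = [Balaban1984PropagatorsII];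
[15] = [Balaban1985Variational]; [I] = [Balaban1987RG1].

v1.1 (g4, 2026-08-28; DOCSTRING-ONLY, append protocol — the three theorems and their proofs are byte-identical to v1.0 p599633; referee ref-G g20 READ297 PASS, NIT-1 ∕ NOTE-2):
(NIT-1) v1.0's «WHAT THIS FILE PROVES» announced a §3 `record13SepCoPHBody_of_stub1_thm33γAvg_stub3A'` that is NOT in the file — the announcement is withdrawn below (the K0⁷-body
composition on this road is BY NAME dag-n21-c's PART 2 `K0PrintCubeOfStepTokensR.record13SepCoPHBody_of_stubs1_2P_3A'` with `h2P F :=` §2's conclusion once §2's displayed inputs are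
supplied at every `F`; nothing is gained by restating it here) and the unused `open … (record13SepCoPHBody_of_stubs1_2P_3A')` item is dropped.  (NOTE-2, dictionary precision) print's
pairing on [4] p. 391 L31–32 → p. 392 L2 is the NORMALISED trace «X·Y = tr XY … tr 1 = 1», i.e. `tr = Tr∕2` on `M₂(ℂ)`; this file's `τ := Matrix.traceLinearMap (Fin 2) ℂ ℂ` is the
UNNORMALISED `Tr` with `C_τ = 2`.  Remark (referee's, NOT typed in this file): the `τ`-transpose `entryT τ` — hence the letter `withQQP τ …` at which `hinv` is displayed — is
the transpose with respect to the form `Re τ(X* Y)`, and a transpose does not change when its form is rescaled by a positive constant, so a supplier of `hinv` read from print's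
normalised `tr` should meet the same letter; the constants `C_τ`, `β_τ` of D3γ′ are bookkeeping functions of the chosen `τ` (here `C_τ = 2`).  Every «`τ = tr`» below means this `τ`.

WHY.  This seat's «D2γ» `K0Stub2OfSockGamma.prop6MemberB8At_of_thm33γ` (p588442) reduces V18's stub-2 body BY NAME to {`B9.Thm33Printed`, dag-n06-b's six member-local γ binders on the
datum-carrying cube sub-family, Prop. 5's two ∃ sockets}; referee READ-55 NIT (2): the averaging binder `havg` is unguarded ∕ a free hypothesis about an abstract letter `ops.QQ`.  The
Literature file «D3γ′» `B8Prop6CubeMemberOfThm33GammaAvg.prop6Printed_zdCub_of_thm33γ₄` (this seat, g3) DISCHARGES it: the averaging term is print's genuine `Q*aQ` (3.16) over print's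
split class (dag-n06-b `withQQP` ∕ `avgAtγ_withQQP`, dag-n05-c `levelSepPP_cubeLamBP'_trunc'`).  THIS FILE is the K0 end at NODE 00's objects (`d = 4`, `𝔸 = M₂(ℂ)`, `L = F.L`), with
print's pairing functional `τ := tr` and its one remaining side condition — the bound `|Re tr(x*y)| ≤ C_τ‖x‖‖y‖` in the `L²`-operator norm — PROVED (`C_τ = 2`, §0).

WHAT THIS FILE PROVES (theorems only; 0 `def`; nothing modified; nothing of Bałaban asserted).
§0 `abs_re_trace_star_mul_le` — `|Re tr(x* y)| ≤ 2‖x‖‖y‖` on `M₂(ℂ)` with the `L²`-operator norm (`|tr M| ≤ Σ_i |M_ii| ≤ 2‖M‖`, `‖x*y‖ ≤ ‖x‖‖y‖`; entries vs operator norm by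
   `Literature.Barriers.QuantumFields.norm_entry_le_l2_opNorm` (module `UnitaryHaarSmallBall`)).
§1 ★★ `prop6MemberB8At_of_thm33γAvg` — V18's stub-2 BODY `∃ B₁ c₁, 0 ≤ B₁ ∧ 0 < c₁ ∧ B8.Prop6Printed 4 L B₁ c₁ (zdCub (M₂ℂ) F.L ·)` FROM: a [4] frame `(geo, bg, GA)` with member readings
   `mem ∕ ιCfg ∕ ιLoc`, ANY letter family `ops₀` (its `QQ` field is ignored), `h33 : B9.Thm33Printed …` BY NAME, the binders `DictAt`, `Prop6At`, `CurvAt`, `LandauAt` (at `ops₀`) and `InvAt`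
   AT THE GENUINE LETTER `withQQP tr F.L ΛbT ops₀` on the datum-carrying cube sub-family, signs of the constants; THEN `∃ B₀ˢ ≥ 1` such that Prop. 5's two ∃ sockets at `B₀ˢ` give the
   body.  = D2γ's `prop6MemberB8At_of_thm33γ` with `havg` (and `q`, `hq`) GONE.
§2 ★ `prop6MemberB8AtP_of_thm33γAvg` — the same with V19's registered stub-2′ TEXT as conclusion (`∃ ρ₀ ≥ 1, ∃ B₁ c₁, … zdCubP (M₂ℂ) F.L ρ₀ ·` — `K0V19Defs.Prop6MemberB8AtP F` by `rfl`;
   the route-importing mirror is deliberately not imported here, `lint.theses-cone`), through dag-n21-c's `prop6MemberP_of_prop6Member` (FULL ⇒ PRINT-CUT at `ρ₀ = 1`).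
(No §3.  v1.0 announced here a §3 `record13SepCoPHBody_of_stub1_thm33γAvg_stub3A'`; it was never part of the file and is WITHDRAWN (v1.1, NIT-1): K0⁷'s body on this road is the
   by-name composition of §2's conclusion with dag-n21-c's PART 2 `K0PrintCubeOfStepTokensR.record13SepCoPHBody_of_stubs1_2P_3A'` (slot `h2P`) — CONDITIONAL on stub 1, stub 3ᴬ′
   and §2's displayed inputs at every `F`; K0⁷ is NOT closed by this road and nothing here claims it.)

HONEST SCOPE ∕ A1–A6 (director-ym №189 (3)).  (A1) K0⁷ stmt-QuantumFields-20541 OPEN (stubs 1 ∧ 3ᴬ′); V19's stub 2′ is ALREADY landed by name via the flat line (p593845 ∕ p595104) —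
this road is an ALTERNATIVE supplier and moves nothing.  (A2) the Thm-3.3 inputs are DISPLAYED HYPOTHESES, NOT exhibited: `B9.Thm33Printed` (N06's node), the dictionary∕letters
(`DictAt`, `Prop6At`, `CurvAt`, `LandauAt`; `InvAt` at the genuine letter = [4] (3.27) for the operator (3.26) WITH its averaging term — N06's object layer), Prop. 5's two ∃ sockets at cube
members (N05's Prop.-5 lane, no cube-member provider in tree); dag-n06-b's `m = 0` witness concerns a FREE letter family and does not transfer to the pinned `QQ`; no
joint-satisfiability claim.  (A3) no restatement of a stub: §2's conclusion is V19's text by body; §1's is V18's.  (A4) witnesses: D3γ′'s `B₀ˢ`, `c₁`; `ρ₀ = 1`.  (A6) LOCATED-CARRIER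
unchanged (every `CubeB8` cube incl. collars `ρ = L`, k0-s2-w2 p584299).  Counts unmoved (typed 28∕28 · discharged 5∕27); N05 ∕ N06 NOT discharged; one finite 𝕋⁴ programme at fixed
`ε = L^{−K}`, Bałaban AS PRINTED — NOT continuum ∕ ℝ⁴ ∕ OS ∕ mass gap ∕ Clay: the Yang–Mills mass gap is NOT proved by any of this; route R4 closes the CONDITIONAL finite-𝕋⁴ rung
`BalabanLadder.UV` only.  No `sorry`, `def`, `instance`, `notation`; standard axioms; default heartbeats.
-/

noncomputable section

open scoped Matrix.Norms.L2Operator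

namespace Summit.QuantumFields.YangMills.Theorems.K0Stub2OfSockGammaAvg

open Literature.MathematicalPhysics.QuantumFieldTheory.Balaban1983to89
open Literature.MathematicalPhysics.QuantumFieldTheory.Balaban1983to89.Node00
open Literature.MathematicalPhysics.QuantumFieldTheory.Balaban1983to89.T4Continuum
open Literature.MathematicalPhysics.QuantumFieldTheory.Balaban1983to89.FlowStep
open Literature.MathematicalPhysics.QuantumFieldTheory.Balaban1983to89.B8LeafModelZd (ZdIdx SockP5base SockP5)
open Literature.MathematicalPhysics.QuantumFieldTheory.Balaban1983to89.B7Prop2Explicit (unitaryUnits)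
open Literature.MathematicalPhysics.QuantumFieldTheory.Balaban1983to89.B8Eq131CubesAdmissible (cubeFam)
open Literature.MathematicalPhysics.QuantumFieldTheory.Balaban1983to89.B9SupplySockB9P3ZdLetters (OpsZd)
open Literature.MathematicalPhysics.QuantumFieldTheory.Balaban1983to89.B9SupplySockB9P3ZdAt (DictAt Prop6At InvAt CurvAt LandauAt)
open Literature.MathematicalPhysics.QuantumFieldTheory.Balaban1983to89.B9SupplySockB9P3ZdGamma (cubeLamBP')
open Literature.MathematicalPhysics.QuantumFieldTheory.Balaban1983to89.B9Eq316AveragingTransposeZdPrinted (withQQP)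
open Literature.MathematicalPhysics.QuantumFieldTheory.Balaban1983to89.B8CubeMemberZd (cubeLamS cubeLamB)
open Literature.MathematicalPhysics.QuantumFieldTheory.Balaban1983to89.B8Prop6CubeMemberOfThm33GammaAvg (prop6Printed_zdCub_of_thm33γ₄)
open Literature.Barriers.QuantumFields (norm_entry_le_l2_opNorm)
open Summit.QuantumFields.YangMills.Theorems.K0Stub2OfPrintedZdCub (prop6MemberB8At_of_prop6Printed)
open Summit.QuantumFields.YangMills.Theorems.K0PrintCubeOfStepTokensR (prop6MemberP_of_prop6Member)

variable (F : T4Family)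

/-! ## §0 Print's pairing `τ = tr` on `M₂(ℂ)`: the trace bound in the `L²`-operator norm -/

/-- **`|Re tr(x* y)| ≤ 2‖x‖‖y‖` on `M₂(ℂ)`** (operator norm): `|Re z| ≤ ‖z‖`, `‖tr M‖ ≤ Σ_i ‖M_ii‖ ≤ 2‖M‖` (entries are bounded by the operator norm), `‖x* y‖ ≤ ‖x*‖‖y‖ = ‖x‖‖y‖`.
The side condition `hCτ` of dag-n06-b's `avgAtγ_withQQP` ∕ D3γ′ at print's pairing ([4] p. 391 «X·Y = tr XY»), `C_τ = 2`. [cite: Balaban1985BackgroundPropagators, p.391 (the trace pairing; bookkeeping)] -/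
theorem abs_re_trace_star_mul_le :
    letI : CStarAlgebra (MatA 2) := {}
    ∀ x y : MatA 2, |((Matrix.traceLinearMap (Fin 2) ℂ ℂ) (star x * y)).re| ≤ 2 * ‖x‖ * ‖y‖ := by
  letI : CStarAlgebra (MatA 2) := {}
  intro x y
  have htr : ∀ M : MatA 2, ‖Matrix.trace M‖ ≤ 2 * ‖M‖ := by
    intro M
    rw [Matrix.trace, Fin.sum_univ_two, Matrix.diag_apply, Matrix.diag_apply]
    calc ‖M 0 0 + M 1 1‖ ≤ ‖M 0 0‖ + ‖M 1 1‖ := norm_add_le _ _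
      _ ≤ ‖M‖ + ‖M‖ := add_le_add (norm_entry_le_l2_opNorm M 0 0) (norm_entry_le_l2_opNorm M 1 1)
      _ = 2 * ‖M‖ := by ring
  have h1 : |((Matrix.traceLinearMap (Fin 2) ℂ ℂ) (star x * y)).re| ≤ ‖Matrix.trace (star x * y)‖ := by
    rw [Matrix.traceLinearMap_apply]
    exact Complex.abs_re_le_norm _
  refine h1.trans ((htr _).trans ?_)
  have h2 : ‖star x * y‖ ≤ ‖x‖ * ‖y‖ := (norm_mul_le _ _).trans (by rw [norm_star])
  nlinarith [h2, norm_nonneg x, norm_nonneg y]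

/-! ## §1 ★★ V18's stub-2 body from Theorem 3.3 by name, genuine averaging letter -/

/-- **★★ V18 STUB 2's BODY FROM [4] THEOREM 3.3 BY NAME, EDITION γ, GENUINE AVERAGING LETTER — the K0 end of «D3γ′».**  DISPLAYED: a [4] frame `(geo, bg, GA)` with the member
readings `mem ∕ ιCfg ∕ ιLoc` of the `ℤ⁴ × M₂(ℂ)` data, any letter family `ops₀` (its `QQ` field is replaced by print's `Q*aQ`), `h33 : B9.Thm33Printed c35 geo bg Gp GA` (N06's node, BY NAME),
the member-local binders `DictAt`, `Prop6At`, `CurvAt`, `LandauAt` (at `ops₀`) and `InvAt` at the genuine letter `withQQP tr F.L ΛbT ops₀` (ΛbT = the truncated split class of the member's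
cube datum) on the datum-carrying cube sub-family of `ZdIdx 4 F.L`, the constants' signs; THEN `∃ B₀ˢ ≥ 1` such that for all `B₀′, c_P > 0` and Proposition 5's two EXISTENCE sockets at `B₀ˢ`
at every cube datum, the stub-2 body holds (`B₁ = 20·L·B₀ˢ`).  = `prop6Printed_zdCub_of_thm33γ₄` at `𝔸 := M₂(ℂ)`, `d := 4`, `τ := tr` (§0), `f := id`, through the door
`prop6MemberB8At_of_prop6Printed`.  NO averaging binder.  A2∕A6 in the module docstring.
[cite: Balaban1985RegularSpaces, Prop. 6 p.99, Prop. 3 p.87, Thm 4 p.88, Prop. 5 (1.107)–(1.108) p.94, (1.56)–(1.59) p.86, (1.31) p.82; Balaban1985BackgroundPropagators, Thm 3.3 p.399, (3.16) p.393, (3.26)–(3.27) p.395; Balaban1984PropagatorsII, (2.3) p.224] -/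
theorem prop6MemberB8At_of_thm33γAvg
    {I : Type} (geo : I → B9.Geometry) (bg : I → B9.Backgrounds) (GA : ∀ i, B9.KernelFamily (geo i) (bg i))
    (mem : ℝ → ZdIdx 4 F.L → ℕ → I)
    (ιCfg : letI : CStarAlgebra (MatA 2) := {};
      ∀ (M : ℝ) (i : ZdIdx 4 F.L) (m : ℕ) (U₀ : B7Prop1Explicit.Site 4 → Fin 4 → (MatA 2)ˣ),
        (∀ x κ, U₀ x κ ∈ unitaryUnits (MatA 2)) → (bg (mem M i m)).Cfg)
    (ιLoc : ∀ (M : ℝ) (i : ZdIdx 4 F.L) (m : ℕ), (B7Prop1Explicit.Site 4 → Fin 4 → MatA 2) → (geo (mem M i m)).Loc)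
    (ops₀ : letI : CStarAlgebra (MatA 2) := {}; ℝ → ZdIdx 4 F.L → ℕ → OpsZd 4 (MatA 2)) {c35 c₆ K₆ M₃ a₃ c69 : ℝ}
    {Gp : ∀ i, B9.KernelFamily (geo i) (bg i)} (h33 : B9.Thm33Printed c35 geo bg Gp GA)
    (hdict : letI : CStarAlgebra (MatA 2) := {};
      ∀ (M : ℝ) (j : {q : ZdIdx 4 F.L × (B7Prop1Explicit.Site 4 × ℕ × ℕ) // F.L ≤ q.2.2.2 ∧ q.2.2.2 ≤ q.2.2.1 ∧ 11 * 4 < q.2.2.1 ∧ F.L ≤ 4 * q.2.2.1 ∧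
          q.1.Ω = cubeFam false F.L q.2.1 q.2.2.1 q.2.2.2 q.1.k ∧ q.1.Λs = cubeLamS F.L q.2.1 q.2.2.1 q.2.2.2 q.1.k ∧ q.1.Λb = cubeLamB F.L q.2.1 q.2.2.1 q.2.2.2 q.1.k})
        (m : ℕ), DictAt geo bg GA F.L mem ιCfg ιLoc ops₀ M j.1.1 m)
    (hP6 : letI : CStarAlgebra (MatA 2) := {};
      ∀ (M : ℝ) (j : {q : ZdIdx 4 F.L × (B7Prop1Explicit.Site 4 × ℕ × ℕ) // F.L ≤ q.2.2.2 ∧ q.2.2.2 ≤ q.2.2.1 ∧ 11 * 4 < q.2.2.1 ∧ F.L ≤ 4 * q.2.2.1 ∧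
          q.1.Ω = cubeFam false F.L q.2.1 q.2.2.1 q.2.2.2 q.1.k ∧ q.1.Λs = cubeLamS F.L q.2.1 q.2.2.1 q.2.2.2 q.1.k ∧ q.1.Λb = cubeLamB F.L q.2.1 q.2.2.1 q.2.2.2 q.1.k})
        (m : ℕ), M₃ ≤ M → Prop6At bg F.L mem ιCfg c35 c₆ K₆ M j.1.1 m)
    (hinv : letI : CStarAlgebra (MatA 2) := {};
      ∀ (M : ℝ) (j : {q : ZdIdx 4 F.L × (B7Prop1Explicit.Site 4 × ℕ × ℕ) // F.L ≤ q.2.2.2 ∧ q.2.2.2 ≤ q.2.2.1 ∧ 11 * 4 < q.2.2.1 ∧ F.L ≤ 4 * q.2.2.1 ∧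
          q.1.Ω = cubeFam false F.L q.2.1 q.2.2.1 q.2.2.2 q.1.k ∧ q.1.Λs = cubeLamS F.L q.2.1 q.2.2.1 q.2.2.2 q.1.k ∧ q.1.Λb = cubeLamB F.L q.2.1 q.2.2.1 q.2.2.2 q.1.k})
        (m : ℕ), M₃ ≤ M → InvAt bg F.L mem ιCfg
          (withQQP (Matrix.traceLinearMap (Fin 2) ℂ ℂ) F.L
            (fun m' => if m' ≤ j.1.1.k then cubeLamBP' F.L j.1.2.1 j.1.2.2.1 j.1.2.2.2 j.1.1.k m' else fun _ => ∅) ops₀) c35 a₃ M j.1.1 m)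
    (hcurv : letI : CStarAlgebra (MatA 2) := {};
      ∀ (M : ℝ) (j : {q : ZdIdx 4 F.L × (B7Prop1Explicit.Site 4 × ℕ × ℕ) // F.L ≤ q.2.2.2 ∧ q.2.2.2 ≤ q.2.2.1 ∧ 11 * 4 < q.2.2.1 ∧ F.L ≤ 4 * q.2.2.1 ∧
          q.1.Ω = cubeFam false F.L q.2.1 q.2.2.1 q.2.2.2 q.1.k ∧ q.1.Λs = cubeLamS F.L q.2.1 q.2.2.1 q.2.2.2 q.1.k ∧ q.1.Λb = cubeLamB F.L q.2.1 q.2.2.1 q.2.2.2 q.1.k})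
        (m : ℕ), M₃ ≤ M → CurvAt bg F.L mem ιCfg ops₀ c35 a₃ c69 M j.1.1 m)
    (hlan : letI : CStarAlgebra (MatA 2) := {};
      ∀ (M : ℝ) (j : {q : ZdIdx 4 F.L × (B7Prop1Explicit.Site 4 × ℕ × ℕ) // F.L ≤ q.2.2.2 ∧ q.2.2.2 ≤ q.2.2.1 ∧ 11 * 4 < q.2.2.1 ∧ F.L ≤ 4 * q.2.2.1 ∧
          q.1.Ω = cubeFam false F.L q.2.1 q.2.2.1 q.2.2.2 q.1.k ∧ q.1.Λs = cubeLamS F.L q.2.1 q.2.2.1 q.2.2.2 q.1.k ∧ q.1.Λb = cubeLamB F.L q.2.1 q.2.2.1 q.2.2.2 q.1.k})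
        (m : ℕ), M₃ ≤ M → LandauAt bg F.L mem ιCfg ops₀ c35 a₃ M j.1.1 m)
    (hc₆ : 0 < c₆) (hK₆ : 0 < K₆) (ha₃ : 0 < a₃) (hc69 : 0 ≤ c69) :
    ∃ B₀S : ℝ, 1 ≤ B₀S ∧ ∀ {B₀' cP : ℝ}, 0 < B₀' → 0 < cP →
      (letI : CStarAlgebra (MatA 2) := {};
        ∀ (η : ℝ), 0 < η → ∀ (k : ℕ), 1 ≤ k → ∀ (a : B7Prop1Explicit.Site 4) (M ρ : ℕ), F.L ≤ ρ → ρ ≤ M → 11 * 4 < M → F.L ≤ 4 * M →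
          SockP5base (𝔸 := MatA 2) F.L B₀S B₀' cP η k (cubeFam false F.L a M ρ k) (cubeLamS F.L a M ρ k)) →
      (letI : CStarAlgebra (MatA 2) := {};
        ∀ (η : ℝ), 0 < η → ∀ (k : ℕ), 1 ≤ k → ∀ (a : B7Prop1Explicit.Site 4) (M ρ : ℕ), F.L ≤ ρ → ρ ≤ M → 11 * 4 < M → F.L ≤ 4 * M →
          SockP5 (𝔸 := MatA 2) F.L B₀S B₀' cP η k (cubeFam false F.L a M ρ k) (cubeLamS F.L a M ρ k)) →
      ∃ B₁ c₁ : ℝ, 0 ≤ B₁ ∧ 0 < c₁ ∧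
        (letI : CStarAlgebra (MatA 2) := {}; B8.Prop6Printed 4 (F.L : ℝ) B₁ c₁ (fun i : ZdIdx 4 F.L => zdCub (MatA 2) F.L i)) := by
  letI : CStarAlgebra (MatA 2) := {}
  have hL : 2 ≤ F.L := by have := F.hL11; omega
  obtain ⟨B₀S, hB₀S, H⟩ := prop6Printed_zdCub_of_thm33γ₄ (𝔸 := MatA 2) (d := 4) geo bg GA F.L mem ιCfg ιLoc (Matrix.traceLinearMap (Fin 2) ℂ ℂ) ops₀
    (by norm_num) hL (abs_re_trace_star_mul_le) h33 hdict hP6 hinv hcurv hlan hc₆ hK₆ ha₃ hc69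
  refine ⟨B₀S, hB₀S, fun hB₀' hcP S5b S5 => ?_⟩
  obtain ⟨c₁, hc₁, G⟩ := H hB₀' hcP S5b S5
  have hL0 : (0 : ℝ) ≤ (F.L : ℝ) := Nat.cast_nonneg _
  have hB0 : (0 : ℝ) ≤ B₀S := le_trans zero_le_one hB₀S
  exact prop6MemberB8At_of_prop6Printed F (by positivity) hc₁ (G (fun i => i))

/-! ## §2 ★ V19's registered stub-2′ TEXT from the same inputs -/

/-- **★ V19's STUB-2′ TEXT FROM [4] THEOREM 3.3 BY NAME, EDITION γ, GENUINE AVERAGING LETTER**: the conclusion of §1 on print's p. 98 class `zdCubP (M₂ℂ) F.L ρ₀` for SOME `ρ₀ ≥ 1`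
(= `K0V19Defs.Prop6MemberB8AtP F`, the registered text of `stub_prop6MemberB8AtP13`, by `rfl`) — §1 through dag-n21-c's `prop6MemberP_of_prop6Member` (FULL ⇒ PRINT-CUT, `ρ₀ = 1`).
An ALTERNATIVE supplier of the already-landed stub 2′ (flat line, p595104); hypotheses as in §1.
[cite: Balaban1985RegularSpaces, Prop. 6 (1.135)–(1.138) p.99, p.98, Prop. 5 p.94, (1.59) p.86; Balaban1985BackgroundPropagators, Thm 3.3 p.399, (3.16) p.393, (3.26)–(3.27) p.395] -/
theorem prop6MemberB8AtP_of_thm33γAvg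
    {I : Type} (geo : I → B9.Geometry) (bg : I → B9.Backgrounds) (GA : ∀ i, B9.KernelFamily (geo i) (bg i))
    (mem : ℝ → ZdIdx 4 F.L → ℕ → I)
    (ιCfg : letI : CStarAlgebra (MatA 2) := {};
      ∀ (M : ℝ) (i : ZdIdx 4 F.L) (m : ℕ) (U₀ : B7Prop1Explicit.Site 4 → Fin 4 → (MatA 2)ˣ),
        (∀ x κ, U₀ x κ ∈ unitaryUnits (MatA 2)) → (bg (mem M i m)).Cfg)
    (ιLoc : ∀ (M : ℝ) (i : ZdIdx 4 F.L) (m : ℕ), (B7Prop1Explicit.Site 4 → Fin 4 → MatA 2) → (geo (mem M i m)).Loc)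
    (ops₀ : letI : CStarAlgebra (MatA 2) := {}; ℝ → ZdIdx 4 F.L → ℕ → OpsZd 4 (MatA 2)) {c35 c₆ K₆ M₃ a₃ c69 : ℝ}
    {Gp : ∀ i, B9.KernelFamily (geo i) (bg i)} (h33 : B9.Thm33Printed c35 geo bg Gp GA)
    (hdict : letI : CStarAlgebra (MatA 2) := {};
      ∀ (M : ℝ) (j : {q : ZdIdx 4 F.L × (B7Prop1Explicit.Site 4 × ℕ × ℕ) // F.L ≤ q.2.2.2 ∧ q.2.2.2 ≤ q.2.2.1 ∧ 11 * 4 < q.2.2.1 ∧ F.L ≤ 4 * q.2.2.1 ∧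
          q.1.Ω = cubeFam false F.L q.2.1 q.2.2.1 q.2.2.2 q.1.k ∧ q.1.Λs = cubeLamS F.L q.2.1 q.2.2.1 q.2.2.2 q.1.k ∧ q.1.Λb = cubeLamB F.L q.2.1 q.2.2.1 q.2.2.2 q.1.k})
        (m : ℕ), DictAt geo bg GA F.L mem ιCfg ιLoc ops₀ M j.1.1 m)
    (hP6 : letI : CStarAlgebra (MatA 2) := {};
      ∀ (M : ℝ) (j : {q : ZdIdx 4 F.L × (B7Prop1Explicit.Site 4 × ℕ × ℕ) // F.L ≤ q.2.2.2 ∧ q.2.2.2 ≤ q.2.2.1 ∧ 11 * 4 < q.2.2.1 ∧ F.L ≤ 4 * q.2.2.1 ∧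
          q.1.Ω = cubeFam false F.L q.2.1 q.2.2.1 q.2.2.2 q.1.k ∧ q.1.Λs = cubeLamS F.L q.2.1 q.2.2.1 q.2.2.2 q.1.k ∧ q.1.Λb = cubeLamB F.L q.2.1 q.2.2.1 q.2.2.2 q.1.k})
        (m : ℕ), M₃ ≤ M → Prop6At bg F.L mem ιCfg c35 c₆ K₆ M j.1.1 m)
    (hinv : letI : CStarAlgebra (MatA 2) := {};
      ∀ (M : ℝ) (j : {q : ZdIdx 4 F.L × (B7Prop1Explicit.Site 4 × ℕ × ℕ) // F.L ≤ q.2.2.2 ∧ q.2.2.2 ≤ q.2.2.1 ∧ 11 * 4 < q.2.2.1 ∧ F.L ≤ 4 * q.2.2.1 ∧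
          q.1.Ω = cubeFam false F.L q.2.1 q.2.2.1 q.2.2.2 q.1.k ∧ q.1.Λs = cubeLamS F.L q.2.1 q.2.2.1 q.2.2.2 q.1.k ∧ q.1.Λb = cubeLamB F.L q.2.1 q.2.2.1 q.2.2.2 q.1.k})
        (m : ℕ), M₃ ≤ M → InvAt bg F.L mem ιCfg
          (withQQP (Matrix.traceLinearMap (Fin 2) ℂ ℂ) F.L
            (fun m' => if m' ≤ j.1.1.k then cubeLamBP' F.L j.1.2.1 j.1.2.2.1 j.1.2.2.2 j.1.1.k m' else fun _ => ∅) ops₀) c35 a₃ M j.1.1 m)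
    (hcurv : letI : CStarAlgebra (MatA 2) := {};
      ∀ (M : ℝ) (j : {q : ZdIdx 4 F.L × (B7Prop1Explicit.Site 4 × ℕ × ℕ) // F.L ≤ q.2.2.2 ∧ q.2.2.2 ≤ q.2.2.1 ∧ 11 * 4 < q.2.2.1 ∧ F.L ≤ 4 * q.2.2.1 ∧
          q.1.Ω = cubeFam false F.L q.2.1 q.2.2.1 q.2.2.2 q.1.k ∧ q.1.Λs = cubeLamS F.L q.2.1 q.2.2.1 q.2.2.2 q.1.k ∧ q.1.Λb = cubeLamB F.L q.2.1 q.2.2.1 q.2.2.2 q.1.k})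
        (m : ℕ), M₃ ≤ M → CurvAt bg F.L mem ιCfg ops₀ c35 a₃ c69 M j.1.1 m)
    (hlan : letI : CStarAlgebra (MatA 2) := {};
      ∀ (M : ℝ) (j : {q : ZdIdx 4 F.L × (B7Prop1Explicit.Site 4 × ℕ × ℕ) // F.L ≤ q.2.2.2 ∧ q.2.2.2 ≤ q.2.2.1 ∧ 11 * 4 < q.2.2.1 ∧ F.L ≤ 4 * q.2.2.1 ∧
          q.1.Ω = cubeFam false F.L q.2.1 q.2.2.1 q.2.2.2 q.1.k ∧ q.1.Λs = cubeLamS F.L q.2.1 q.2.2.1 q.2.2.2 q.1.k ∧ q.1.Λb = cubeLamB F.L q.2.1 q.2.2.1 q.2.2.2 q.1.k})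
        (m : ℕ), M₃ ≤ M → LandauAt bg F.L mem ιCfg ops₀ c35 a₃ M j.1.1 m)
    (hc₆ : 0 < c₆) (hK₆ : 0 < K₆) (ha₃ : 0 < a₃) (hc69 : 0 ≤ c69) :
    ∃ B₀S : ℝ, 1 ≤ B₀S ∧ ∀ {B₀' cP : ℝ}, 0 < B₀' → 0 < cP →
      (letI : CStarAlgebra (MatA 2) := {};
        ∀ (η : ℝ), 0 < η → ∀ (k : ℕ), 1 ≤ k → ∀ (a : B7Prop1Explicit.Site 4) (M ρ : ℕ), F.L ≤ ρ → ρ ≤ M → 11 * 4 < M → F.L ≤ 4 * M →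
          SockP5base (𝔸 := MatA 2) F.L B₀S B₀' cP η k (cubeFam false F.L a M ρ k) (cubeLamS F.L a M ρ k)) →
      (letI : CStarAlgebra (MatA 2) := {};
        ∀ (η : ℝ), 0 < η → ∀ (k : ℕ), 1 ≤ k → ∀ (a : B7Prop1Explicit.Site 4) (M ρ : ℕ), F.L ≤ ρ → ρ ≤ M → 11 * 4 < M → F.L ≤ 4 * M →
          SockP5 (𝔸 := MatA 2) F.L B₀S B₀' cP η k (cubeFam false F.L a M ρ k) (cubeLamS F.L a M ρ k)) →
      ∃ (ρ₀ : ℕ) (B₁ c₁ : ℝ), 1 ≤ ρ₀ ∧ 0 ≤ B₁ ∧ 0 < c₁ ∧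
        (letI : CStarAlgebra (MatA 2) := {}; B8.Prop6Printed 4 (F.L : ℝ) B₁ c₁ (fun i : ZdIdx 4 F.L => zdCubP (MatA 2) F.L ρ₀ i)) := by
  obtain ⟨B₀S, hB₀S, H⟩ := prop6MemberB8At_of_thm33γAvg F geo bg GA mem ιCfg ιLoc ops₀ h33 hdict hP6 hinv hcurv hlan hc₆ hK₆ ha₃ hc69
  exact ⟨B₀S, hB₀S, fun hB₀' hcP S5b S5 => prop6MemberP_of_prop6Member F (H hB₀' hcP S5b S5)⟩

end Summit.QuantumFields.YangMills.Theorems.K0Stub2OfSockGammaAvg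

end
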